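import Summits.CriticalPhenomena.PercolationContinuityZ3.Theorems.PercNearOneGluingNoHeavyLowerTailKnQuestion8CoefficientwiseCoreClassKernelMixBridgeCells
import HarnessLib

/-!
# KB-MIX along a BRIDGE: the abstract bookkeeping theorems (THEOREM A = KB-MIX-FULL of the bridge, THEOREM B = one-sided extension)

Support file (`--supports stmt-CriticalPhenomena-4575`, closed), prover `prim-cplus-coupling` (gen 36).  No definitions, no notations, no named facts,
no sorries; standard axioms.  Memo `prim-cplus-coupling/A5-COUPLING-gen36.md` §2.  Companion of `…CoreClassKernelMixBridgeCells` (the cells D1–D4 and the free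
full anti-sum) and `…CoreClassKernelMixBridge` (the graph form).

Abstract setting (as in `…BridgeCells`): sides `P₁ = C_a`, `X₁ = C_{c₁}` on `2^{E₁}` and `X₂ = C_{c₂}`, `R₂ = C_b` on `2^{E₂}`, entering only through
`X₁ ⊆ P₁` on `{c₁ ∈ P₁}` and `a ∈ X₁ ↔ c₁ ∈ P₁`; the bridge graph `H = E₁ ⊔ {c₁c₂} ⊔ E₂` has, for `ω = ω₁ ∪ [e] ∪ ω₂`,
`e` red: `C_a ω = P₁ ∪ {y | c₁ ∈ P₁ ∧ y ∈ insert c₁ X₂}`, `C_b ω = R₂ ∪ {y | c₂ ∈ R₂ ∧ y ∈ insert c₂ X₁}`, `C_b(H∖ω) = R₂(E₂∖ω₂)`;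
`e` blue: `C_a ω = P₁`, `C_b ω = R₂`, `C_b(H∖ω) = R₂(E₂∖ω₂) ∪ {y | c₂ ∈ R₂(E₂∖ω₂) ∧ y ∈ insert c₂ (X₁(E₁∖ω₁))}`.
ONE-SIDED(E; x, y) ('contact at `x` allowed'): `Σ_ω h(S)k(S) + Σ_{y ∉ C_x ω} (hˣ(C_x ω) − hʸ(C_y(E∖ω)))(kˣ(C_x ω) − kʸ(C_y(E∖ω))) ≥ 0`.
* `Coefficientwise.bridge_master` — the bookkeeping with an arbitrary extra condition `W` on the red-route rows (memo §2.2: cells D1–D4, every red and every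
  blue supply term used exactly once; D4 after `ω₁ ↦ E₁∖ω₁` and `ω₂ ↦ E₂∖ω₂`, columns exchanged with rows).
* `Coefficientwise.bridge_kernelMixFull_abs` — THEOREM A: ONE-SIDED(E₁; c₁, a) ∧ ONE-SIDED(E₂; c₂, b) ⟹ KB-MIX-FULL(H; a, b).
* `Coefficientwise.bridge_oneSided_abs` — THEOREM B: ONE-SIDED(E₁; c₁, a) ∧ [free full anti-sum of E₂] ⟹ ONE-SIDED(H; b, a): the one-sided form
  propagates across a bridge to ANY graph `E₂` and any new terminal `b` (the contact moves to `b`).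
[cite: KozmaNitzan2024, Questions 8–9 (§5.5 p. 36) (context: the Question-8 pocket covariance programme)]
-/

namespace Summit.CriticalPhenomena.PercolationContinuityZ3.Theorems

open Finset Literature.Probability.Percolation

namespace Coefficientwise

variable {ι V : Type*}

open Classical in
/-- **Bridge bookkeeping (master form).**  Abstract sides `P₁, X₁` (on `2^{E₁}`) and `X₂, R₂` (on `2^{E₂}`) with `X₁ ⊆ P₁` on `{c₁ ∈ P₁}` and the two
symmetry relations `a ∈ X₁ ↔ c₁ ∈ P₁`, `b ∈ X₂ ↔ c₂ ∈ R₂`; ONE-SIDED(E₁; c₁, a) glued by every `B`; and a ROW hypothesis for the rows `{c₁ ∈ P₁ ω₁}` (`e` red)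
with an arbitrary extra condition `W ω₂` on its wall terms.  Conclusion: the bridge sum with red wall condition `c₁ ∉ P₁ ω₁ ∨ W ω₂` and blue wall condition
`¬(c₁ ∈ P₁(E₁∖ω₁) ∧ c₂ ∈ R₂(E₂∖ω₂))` is `≥ 0`.  (THEOREM A: `W = {b ∉ X₂}`; THEOREM B: `W = ⊤`.) [cite: KozmaNitzan2024, Questions 8–9 (§5.5 p. 36) (context)] -/
theorem bridge_master (E₁ E₂ : Finset ι) (c₁ c₂ a : V) (P₁ X₁ X₂ R₂ : Finset ι → Set V) (W : Finset ι → Prop)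
    (hX₁P₁ : ∀ ω₁, ω₁ ⊆ E₁ → c₁ ∈ P₁ ω₁ → X₁ ω₁ ⊆ P₁ ω₁)
    (hcomm₁ : ∀ ω₁, ω₁ ⊆ E₁ → (a ∈ X₁ ω₁ ↔ c₁ ∈ P₁ ω₁))
    (h k ha hb ka kb : Set V → ℝ) (hh : Monotone h) (hk : Monotone k)
    (ha0 : ∀ X, 0 ≤ ha X) (hah : ∀ X, ha X ≤ h X) (hb0 : ∀ X, 0 ≤ hb X) (hbh : ∀ X, hb X ≤ h X)
    (ka0 : ∀ X, 0 ≤ ka X) (kak : ∀ X, ka X ≤ k X) (kb0 : ∀ X, 0 ≤ kb X) (kbk : ∀ X, kb X ≤ k X)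
    (hOS₁ : ∀ B : Set V, 0 ≤ (∑ ω₁ ∈ E₁.powerset, h (B ∪ (X₁ ω₁ ∪ P₁ ω₁)) * k (B ∪ (X₁ ω₁ ∪ P₁ ω₁)))
      + ∑ ω₁ ∈ E₁.powerset.filter (fun ω₁ => a ∉ X₁ ω₁), (hb (B ∪ X₁ ω₁) - ha (P₁ (E₁ \ ω₁))) * (kb (B ∪ X₁ ω₁) - ka (P₁ (E₁ \ ω₁))))
    (hrow₂ : ∀ ω₁, ω₁ ⊆ E₁ → c₁ ∈ P₁ ω₁ → 0 ≤ ∑ ω₂ ∈ E₂.powerset,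
      (h ((P₁ ω₁ ∪ {y | c₁ ∈ P₁ ω₁ ∧ y ∈ insert c₁ (X₂ ω₂)}) ∪ (R₂ ω₂ ∪ {y | c₂ ∈ R₂ ω₂ ∧ y ∈ insert c₂ (X₁ ω₁)})) *
          k ((P₁ ω₁ ∪ {y | c₁ ∈ P₁ ω₁ ∧ y ∈ insert c₁ (X₂ ω₂)}) ∪ (R₂ ω₂ ∪ {y | c₂ ∈ R₂ ω₂ ∧ y ∈ insert c₂ (X₁ ω₁)}))
      + (if W ω₂ then (ha (P₁ ω₁ ∪ {y | c₁ ∈ P₁ ω₁ ∧ y ∈ insert c₁ (X₂ ω₂)}) - hb (R₂ (E₂ \ ω₂))) *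
          (ka (P₁ ω₁ ∪ {y | c₁ ∈ P₁ ω₁ ∧ y ∈ insert c₁ (X₂ ω₂)}) - kb (R₂ (E₂ \ ω₂))) else 0))) :
    0 ≤ ∑ ω₁ ∈ E₁.powerset, ∑ ω₂ ∈ E₂.powerset,
      (h ((P₁ ω₁ ∪ {y | c₁ ∈ P₁ ω₁ ∧ y ∈ insert c₁ (X₂ ω₂)}) ∪ (R₂ ω₂ ∪ {y | c₂ ∈ R₂ ω₂ ∧ y ∈ insert c₂ (X₁ ω₁)})) *
          k ((P₁ ω₁ ∪ {y | c₁ ∈ P₁ ω₁ ∧ y ∈ insert c₁ (X₂ ω₂)}) ∪ (R₂ ω₂ ∪ {y | c₂ ∈ R₂ ω₂ ∧ y ∈ insert c₂ (X₁ ω₁)}))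
      + h (P₁ ω₁ ∪ R₂ ω₂) * k (P₁ ω₁ ∪ R₂ ω₂)
      + (if (c₁ ∉ P₁ ω₁ ∨ W ω₂) then (ha (P₁ ω₁ ∪ {y | c₁ ∈ P₁ ω₁ ∧ y ∈ insert c₁ (X₂ ω₂)}) - hb (R₂ (E₂ \ ω₂))) *
          (ka (P₁ ω₁ ∪ {y | c₁ ∈ P₁ ω₁ ∧ y ∈ insert c₁ (X₂ ω₂)}) - kb (R₂ (E₂ \ ω₂))) else 0)
      + (if ¬ (c₁ ∈ P₁ (E₁ \ ω₁) ∧ c₂ ∈ R₂ (E₂ \ ω₂)) then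
          (ha (P₁ ω₁) - hb (R₂ (E₂ \ ω₂) ∪ {y | c₂ ∈ R₂ (E₂ \ ω₂) ∧ y ∈ insert c₂ (X₁ (E₁ \ ω₁))})) *
          (ka (P₁ ω₁) - kb (R₂ (E₂ \ ω₂) ∪ {y | c₂ ∈ R₂ (E₂ \ ω₂) ∧ y ∈ insert c₂ (X₁ (E₁ \ ω₁))})) else 0)) := by
  -- abbreviations
  set PR : Finset ι → Finset ι → Set V := fun ω₁ ω₂ => P₁ ω₁ ∪ {y | c₁ ∈ P₁ ω₁ ∧ y ∈ insert c₁ (X₂ ω₂)} with hPR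
  set SR : Finset ι → Finset ι → Set V := fun ω₁ ω₂ => PR ω₁ ω₂ ∪ (R₂ ω₂ ∪ {y | c₂ ∈ R₂ ω₂ ∧ y ∈ insert c₂ (X₁ ω₁)}) with hSR
  set QB : Finset ι → Finset ι → Set V := fun ω₁ ω₂ => R₂ (E₂ \ ω₂) ∪ {y | c₂ ∈ R₂ (E₂ \ ω₂) ∧ y ∈ insert c₂ (X₁ (E₁ \ ω₁))} with hQB
  set yR : Finset ι → Finset ι → ℝ := fun ω₁ ω₂ => h (SR ω₁ ω₂) * k (SR ω₁ ω₂) with hyR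
  set yB : Finset ι → Finset ι → ℝ := fun ω₁ ω₂ => h (P₁ ω₁ ∪ R₂ ω₂) * k (P₁ ω₁ ∪ R₂ ω₂) with hyB
  set dR : Finset ι → Finset ι → ℝ := fun ω₁ ω₂ => (ha (PR ω₁ ω₂) - hb (R₂ (E₂ \ ω₂))) * (ka (PR ω₁ ω₂) - kb (R₂ (E₂ \ ω₂))) with hdR
  set dB : Finset ι → Finset ι → ℝ := fun ω₁ ω₂ => (ha (P₁ ω₁) - hb (QB ω₁ ω₂)) * (ka (P₁ ω₁) - kb (QB ω₁ ω₂)) with hdB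
  change ∀ ω₁, ω₁ ⊆ E₁ → c₁ ∈ P₁ ω₁ → 0 ≤ ∑ ω₂ ∈ E₂.powerset, (yR ω₁ ω₂ + (if W ω₂ then dR ω₁ ω₂ else 0)) at hrow₂
  change 0 ≤ ∑ ω₁ ∈ E₁.powerset, ∑ ω₂ ∈ E₂.powerset,
    (yR ω₁ ω₂ + yB ω₁ ω₂ + (if (c₁ ∉ P₁ ω₁ ∨ W ω₂) then dR ω₁ ω₂ else 0) + (if ¬ (c₁ ∈ P₁ (E₁ \ ω₁) ∧ c₂ ∈ R₂ (E₂ \ ω₂)) then dB ω₁ ω₂ else 0))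
  have hh0 : ∀ X, 0 ≤ h X := fun X => le_trans (ha0 X) (hah X)
  have hk0 : ∀ X, 0 ≤ k X := fun X => le_trans (ka0 X) (kak X)
  have hyR0 : ∀ ω₁ ω₂, 0 ≤ yR ω₁ ω₂ := fun ω₁ ω₂ => mul_nonneg (hh0 _) (hk0 _)
  have hyB0 : ∀ ω₁ ω₂, 0 ≤ yB ω₁ ω₂ := fun ω₁ ω₂ => mul_nonneg (hh0 _) (hk0 _)
  -- set identities
  have hPR0 : ∀ ω₁ ω₂, c₁ ∉ P₁ ω₁ → PR ω₁ ω₂ = P₁ ω₁ := by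
    intro ω₁ ω₂ hc; ext y; simp only [hPR, Set.mem_union, Set.mem_setOf_eq]; constructor
    · rintro (hy | ⟨hy, _⟩); exact hy; exact absurd hy hc
    · intro hy; exact Or.inl hy
  have hQB0 : ∀ ω₁ ω₂, c₂ ∉ R₂ (E₂ \ ω₂) → QB ω₁ ω₂ = R₂ (E₂ \ ω₂) := by
    intro ω₁ ω₂ hc; ext y; simp only [hQB, Set.mem_union, Set.mem_setOf_eq]; constructor
    · rintro (hy | ⟨hy, _⟩); exact hy; exact absurd hy hc
    · intro hy; exact Or.inl hy
  have hQB1 : ∀ ω₁ ω₂, c₂ ∈ R₂ (E₂ \ ω₂) → QB ω₁ ω₂ = R₂ (E₂ \ ω₂) ∪ X₁ (E₁ \ ω₁) := by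
    intro ω₁ ω₂ hc; ext y; simp only [hQB, Set.mem_union, Set.mem_setOf_eq, Set.mem_insert_iff]; constructor
    · rintro (hy | ⟨_, hy | hy⟩); exact Or.inl hy; exact Or.inl (hy ▸ hc); exact Or.inr hy
    · rintro (hy | hy); exact Or.inl hy; exact Or.inr ⟨hc, Or.inr hy⟩
  -- (S1) rows without a red route in E₁: cell D1
  have S1 : 0 ≤ ∑ ω₁ ∈ E₁.powerset, ∑ ω₂ ∈ E₂.powerset, (if c₁ ∉ P₁ ω₁ then yB ω₁ ω₂ + dR ω₁ ω₂ else 0) := by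
    refine Finset.sum_nonneg fun ω₁ hω₁ => ?_
    by_cases hr : c₁ ∉ P₁ ω₁
    · simp only [if_pos hr]
      have h1 := bridgeCell_D1 E₂ (P₁ ω₁) R₂ h k ha hb ka kb hh hk ha0 hah hb0 hbh ka0 kak kb0 kbk
      refine le_trans h1 (le_of_eq (Finset.sum_congr rfl fun ω₂ _ => ?_))
      simp only [hyB, hdR, hPR0 ω₁ ω₂ hr]
    · simp only [if_neg hr, Finset.sum_const_zero]; exact le_refl _
  -- (S2) rows with a red route in E₁: the row hypothesis
  have S2 : 0 ≤ ∑ ω₁ ∈ E₁.powerset, ∑ ω₂ ∈ E₂.powerset, (if c₁ ∈ P₁ ω₁ then yR ω₁ ω₂ + (if W ω₂ then dR ω₁ ω₂ else 0) else 0) := by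
    refine Finset.sum_nonneg fun ω₁ hω₁ => ?_
    by_cases hr : c₁ ∈ P₁ ω₁
    · simp only [if_pos hr]; exact hrow₂ ω₁ (Finset.mem_powerset.mp hω₁) hr
    · simp only [if_neg hr, Finset.sum_const_zero]; exact le_refl _
  -- the supply used by the blue cells: blue supply on red-route rows, red supply otherwise
  set yS : Finset ι → Finset ι → ℝ := fun ω₁ ω₂ => if c₁ ∈ P₁ ω₁ then yB ω₁ ω₂ else yR ω₁ ω₂ with hyS
  have hSsub : ∀ ω₁ ω₂, ω₁ ⊆ E₁ → P₁ ω₁ ∪ R₂ ω₂ ∪ {y | c₂ ∈ R₂ ω₂ ∧ y ∈ X₁ ω₁} ⊆ (if c₁ ∈ P₁ ω₁ then P₁ ω₁ ∪ R₂ ω₂ else SR ω₁ ω₂) := by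
    intro ω₁ ω₂ hω₁ y hy
    by_cases hr : c₁ ∈ P₁ ω₁
    · rw [if_pos hr]
      rcases hy with (hy | hy) | ⟨_, hy⟩
      · exact Or.inl hy
      · exact Or.inr hy
      · exact Or.inl (hX₁P₁ ω₁ hω₁ hr hy)
    · rw [if_neg hr]
      rcases hy with (hy | hy) | ⟨hc, hy⟩
      · exact Or.inl (Or.inl hy)
      · exact Or.inr (Or.inl hy)
      · exact Or.inr (Or.inr ⟨hc, Set.mem_insert_of_mem _ hy⟩)
  have hyS_eq : ∀ ω₁ ω₂, yS ω₁ ω₂ = h (if c₁ ∈ P₁ ω₁ then P₁ ω₁ ∪ R₂ ω₂ else SR ω₁ ω₂) * k (if c₁ ∈ P₁ ω₁ then P₁ ω₁ ∪ R₂ ω₂ else SR ω₁ ω₂) := by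
    intro ω₁ ω₂; by_cases hr : c₁ ∈ P₁ ω₁
    · simp only [hyS, if_pos hr, hyB]
    · simp only [hyS, if_neg hr, hyR]
  -- (S3) columns without a blue route in E₂: cell D3 (row by row)
  have S3 : 0 ≤ ∑ ω₁ ∈ E₁.powerset, ∑ ω₂ ∈ E₂.powerset,
      ((if c₂ ∉ R₂ ω₂ then yS ω₁ ω₂ else 0) + (if c₂ ∉ R₂ (E₂ \ ω₂) then dB ω₁ ω₂ else 0)) := by
    refine Finset.sum_nonneg fun ω₁ hω₁ => ?_
    have hω₁ := Finset.mem_powerset.mp hω₁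
    have h3 := bridgeCell_D3 E₂ c₂ (P₁ ω₁) R₂ (fun η => if c₁ ∈ P₁ ω₁ then P₁ ω₁ ∪ R₂ η else SR ω₁ η)
      (fun η _ => le_trans (by intro y hy; exact Or.inl hy) (hSsub ω₁ η hω₁)) h k ha hb ka kb hh hk ha0 hah hb0 hbh ka0 kak kb0 kbk
    have hre : ∑ ω₂ ∈ E₂.powerset, (if c₂ ∉ R₂ (E₂ \ ω₂) then
        h (if c₁ ∈ P₁ ω₁ then P₁ ω₁ ∪ R₂ (E₂ \ ω₂) else SR ω₁ (E₂ \ ω₂)) * k (if c₁ ∈ P₁ ω₁ then P₁ ω₁ ∪ R₂ (E₂ \ ω₂) else SR ω₁ (E₂ \ ω₂)) else 0)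
        = ∑ ω₂ ∈ E₂.powerset, (if c₂ ∉ R₂ ω₂ then yS ω₁ ω₂ else 0) := by
      rw [sum_powerset_sdiff E₂ (fun ω₂ => if c₂ ∉ R₂ ω₂ then
        h (if c₁ ∈ P₁ ω₁ then P₁ ω₁ ∪ R₂ ω₂ else SR ω₁ ω₂) * k (if c₁ ∈ P₁ ω₁ then P₁ ω₁ ∪ R₂ ω₂ else SR ω₁ ω₂) else 0)]
      refine Finset.sum_congr rfl fun ω₂ _ => ?_
      rw [hyS_eq]
    rw [Finset.sum_add_distrib, ← hre, ← Finset.sum_add_distrib]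
    refine le_trans h3 (le_of_eq (Finset.sum_congr rfl fun ω₂ _ => ?_))
    by_cases hc : c₂ ∉ R₂ (E₂ \ ω₂)
    · simp only [if_pos hc, hdB, hQB0 ω₁ ω₂ hc]
    · simp only [if_neg hc]
  -- (S4) columns with a blue route in E₂: cell D4 (column by column), then reindex and exchange the sums
  have S4col : ∀ ω₂, ω₂ ⊆ E₂ → c₂ ∈ R₂ (E₂ \ ω₂) →
      0 ≤ ∑ ω₁ ∈ E₁.powerset, (yS ω₁ (E₂ \ ω₂) + (if c₁ ∉ P₁ (E₁ \ ω₁) then dB ω₁ ω₂ else 0)) := by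
    intro ω₂ hω₂ hc
    have h4 := bridgeCell_D4 E₁ c₁ a (R₂ (E₂ \ ω₂)) P₁ X₁ (fun ω₁ => if c₁ ∈ P₁ ω₁ then P₁ ω₁ ∪ R₂ (E₂ \ ω₂) else SR ω₁ (E₂ \ ω₂)) hcomm₁
      (fun ω₁ hω₁ => le_trans (by
          intro y hy
          rcases hy with hy | hy | hy
          · exact Or.inl (Or.inr hy)
          · exact Or.inr ⟨hc, hy⟩
          · exact Or.inl (Or.inl hy)) (hSsub ω₁ (E₂ \ ω₂) hω₁))
      h k ha hb ka kb hh hk ka0 kak ha0 hah (hOS₁ (R₂ (E₂ \ ω₂)))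
    refine le_trans h4 (le_of_eq (Finset.sum_congr rfl fun ω₁ _ => ?_))
    rw [hyS_eq]
    by_cases hs : c₁ ∉ P₁ (E₁ \ ω₁)
    · simp only [if_pos hs, hdB, hQB1 ω₁ ω₂ hc]
    · simp only [if_neg hs]
  have S4 : 0 ≤ ∑ ω₁ ∈ E₁.powerset, ∑ ω₂ ∈ E₂.powerset,
      ((if c₂ ∈ R₂ ω₂ then yS ω₁ ω₂ else 0) + (if c₂ ∈ R₂ (E₂ \ ω₂) then (if c₁ ∉ P₁ (E₁ \ ω₁) then dB ω₁ ω₂ else 0) else 0)) := by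
    rw [Finset.sum_comm]
    -- reindex the supply part column-wise
    have hre : ∀ ω₁, ∑ ω₂ ∈ E₂.powerset, (if c₂ ∈ R₂ ω₂ then yS ω₁ ω₂ else 0) = ∑ ω₂ ∈ E₂.powerset, (if c₂ ∈ R₂ (E₂ \ ω₂) then yS ω₁ (E₂ \ ω₂) else 0) :=
      fun ω₁ => (sum_powerset_sdiff E₂ (fun ω₂ => if c₂ ∈ R₂ ω₂ then yS ω₁ ω₂ else 0)).symm
    have hsplit : ∑ ω₂ ∈ E₂.powerset, ∑ ω₁ ∈ E₁.powerset,
        ((if c₂ ∈ R₂ ω₂ then yS ω₁ ω₂ else 0) + (if c₂ ∈ R₂ (E₂ \ ω₂) then (if c₁ ∉ P₁ (E₁ \ ω₁) then dB ω₁ ω₂ else 0) else 0))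
        = ∑ ω₂ ∈ E₂.powerset, ∑ ω₁ ∈ E₁.powerset,
          (if c₂ ∈ R₂ (E₂ \ ω₂) then (yS ω₁ (E₂ \ ω₂) + (if c₁ ∉ P₁ (E₁ \ ω₁) then dB ω₁ ω₂ else 0)) else 0) := by
      have e1 : ∑ ω₂ ∈ E₂.powerset, ∑ ω₁ ∈ E₁.powerset, (if c₂ ∈ R₂ ω₂ then yS ω₁ ω₂ else 0)
          = ∑ ω₂ ∈ E₂.powerset, ∑ ω₁ ∈ E₁.powerset, (if c₂ ∈ R₂ (E₂ \ ω₂) then yS ω₁ (E₂ \ ω₂) else 0) := by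
        rw [Finset.sum_comm, Finset.sum_congr rfl fun ω₁ _ => hre ω₁, Finset.sum_comm]
      rw [Finset.sum_congr rfl fun ω₂ _ => (Finset.sum_add_distrib), Finset.sum_add_distrib, e1, ← Finset.sum_add_distrib]
      refine Finset.sum_congr rfl fun ω₂ _ => ?_
      rw [← Finset.sum_add_distrib]
      refine Finset.sum_congr rfl fun ω₁ _ => ?_
      by_cases hc : c₂ ∈ R₂ (E₂ \ ω₂)
      · simp only [if_pos hc]
      · simp only [if_neg hc, add_zero]
    rw [hsplit]
    refine Finset.sum_nonneg fun ω₂ hω₂ => ?_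
    by_cases hc : c₂ ∈ R₂ (E₂ \ ω₂)
    · simp only [if_pos hc]; exact S4col ω₂ (Finset.mem_powerset.mp hω₂) hc
    · simp only [if_neg hc, Finset.sum_const_zero]; exact le_refl _
  -- total = S1 + S2 + S3 + S4, pointwise
  have htot : ∑ ω₁ ∈ E₁.powerset, ∑ ω₂ ∈ E₂.powerset,
      (yR ω₁ ω₂ + yB ω₁ ω₂ + (if (c₁ ∉ P₁ ω₁ ∨ W ω₂) then dR ω₁ ω₂ else 0) + (if ¬ (c₁ ∈ P₁ (E₁ \ ω₁) ∧ c₂ ∈ R₂ (E₂ \ ω₂)) then dB ω₁ ω₂ else 0))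
      = (∑ ω₁ ∈ E₁.powerset, ∑ ω₂ ∈ E₂.powerset, (if c₁ ∉ P₁ ω₁ then yB ω₁ ω₂ + dR ω₁ ω₂ else 0))
        + (∑ ω₁ ∈ E₁.powerset, ∑ ω₂ ∈ E₂.powerset, (if c₁ ∈ P₁ ω₁ then yR ω₁ ω₂ + (if W ω₂ then dR ω₁ ω₂ else 0) else 0))
        + (∑ ω₁ ∈ E₁.powerset, ∑ ω₂ ∈ E₂.powerset, ((if c₂ ∉ R₂ ω₂ then yS ω₁ ω₂ else 0) + (if c₂ ∉ R₂ (E₂ \ ω₂) then dB ω₁ ω₂ else 0)))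
        + (∑ ω₁ ∈ E₁.powerset, ∑ ω₂ ∈ E₂.powerset,
            ((if c₂ ∈ R₂ ω₂ then yS ω₁ ω₂ else 0) + (if c₂ ∈ R₂ (E₂ \ ω₂) then (if c₁ ∉ P₁ (E₁ \ ω₁) then dB ω₁ ω₂ else 0) else 0))) := by
    rw [← Finset.sum_add_distrib, ← Finset.sum_add_distrib, ← Finset.sum_add_distrib]
    refine Finset.sum_congr rfl fun ω₁ _ => ?_
    rw [← Finset.sum_add_distrib, ← Finset.sum_add_distrib, ← Finset.sum_add_distrib]
    refine Finset.sum_congr rfl fun ω₂ _ => ?_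
    simp only [hyS]
    by_cases h1 : c₁ ∈ P₁ ω₁ <;> by_cases h2 : W ω₂ <;> by_cases h3 : c₂ ∈ R₂ ω₂ <;> by_cases h4 : c₂ ∈ R₂ (E₂ \ ω₂) <;>
      by_cases h5 : c₁ ∈ P₁ (E₁ \ ω₁) <;> simp [h1, h2, h3, h4, h5] <;> ring
  rw [htot]
  linarith [S1, S2, S3, S4]


open Classical in
/-- **THEOREM A (abstract bridge rule).**  ONE-SIDED(E₁; c₁, a) (glued by every `B`) and ONE-SIDED(E₂; c₂, b) (glued by every `A`) give KB-MIX-FULL of the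
bridge: the red wall condition is `¬(c₁ ∈ P₁ ω₁ ∧ b ∈ X₂ ω₂)` (no red `a–b` route through `e`), the blue one `¬(c₁ ∈ P₁(E₁∖ω₁) ∧ c₂ ∈ R₂(E₂∖ω₂))`.
[cite: KozmaNitzan2024, Questions 8–9 (§5.5 p. 36) (context)] -/
theorem bridge_kernelMixFull_abs (E₁ E₂ : Finset ι) (c₁ c₂ a b : V) (P₁ X₁ X₂ R₂ : Finset ι → Set V)
    (hX₁P₁ : ∀ ω₁, ω₁ ⊆ E₁ → c₁ ∈ P₁ ω₁ → X₁ ω₁ ⊆ P₁ ω₁)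
    (hcomm₁ : ∀ ω₁, ω₁ ⊆ E₁ → (a ∈ X₁ ω₁ ↔ c₁ ∈ P₁ ω₁))
    (h k ha hb ka kb : Set V → ℝ) (hh : Monotone h) (hk : Monotone k)
    (ha0 : ∀ X, 0 ≤ ha X) (hah : ∀ X, ha X ≤ h X) (hb0 : ∀ X, 0 ≤ hb X) (hbh : ∀ X, hb X ≤ h X)
    (ka0 : ∀ X, 0 ≤ ka X) (kak : ∀ X, ka X ≤ k X) (kb0 : ∀ X, 0 ≤ kb X) (kbk : ∀ X, kb X ≤ k X)
    (hOS₁ : ∀ B : Set V, 0 ≤ (∑ ω₁ ∈ E₁.powerset, h (B ∪ (X₁ ω₁ ∪ P₁ ω₁)) * k (B ∪ (X₁ ω₁ ∪ P₁ ω₁)))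
      + ∑ ω₁ ∈ E₁.powerset.filter (fun ω₁ => a ∉ X₁ ω₁), (hb (B ∪ X₁ ω₁) - ha (P₁ (E₁ \ ω₁))) * (kb (B ∪ X₁ ω₁) - ka (P₁ (E₁ \ ω₁))))
    (hOS₂ : ∀ A : Set V, 0 ≤ (∑ ω₂ ∈ E₂.powerset, h (A ∪ (X₂ ω₂ ∪ R₂ ω₂)) * k (A ∪ (X₂ ω₂ ∪ R₂ ω₂)))
      + ∑ ω₂ ∈ E₂.powerset.filter (fun ω₂ => b ∉ X₂ ω₂), (ha (A ∪ X₂ ω₂) - hb (R₂ (E₂ \ ω₂))) * (ka (A ∪ X₂ ω₂) - kb (R₂ (E₂ \ ω₂)))) :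
    0 ≤ ∑ ω₁ ∈ E₁.powerset, ∑ ω₂ ∈ E₂.powerset,
      (h ((P₁ ω₁ ∪ {y | c₁ ∈ P₁ ω₁ ∧ y ∈ insert c₁ (X₂ ω₂)}) ∪ (R₂ ω₂ ∪ {y | c₂ ∈ R₂ ω₂ ∧ y ∈ insert c₂ (X₁ ω₁)})) *
          k ((P₁ ω₁ ∪ {y | c₁ ∈ P₁ ω₁ ∧ y ∈ insert c₁ (X₂ ω₂)}) ∪ (R₂ ω₂ ∪ {y | c₂ ∈ R₂ ω₂ ∧ y ∈ insert c₂ (X₁ ω₁)}))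
      + h (P₁ ω₁ ∪ R₂ ω₂) * k (P₁ ω₁ ∪ R₂ ω₂)
      + (if ¬ (c₁ ∈ P₁ ω₁ ∧ b ∈ X₂ ω₂) then (ha (P₁ ω₁ ∪ {y | c₁ ∈ P₁ ω₁ ∧ y ∈ insert c₁ (X₂ ω₂)}) - hb (R₂ (E₂ \ ω₂))) *
          (ka (P₁ ω₁ ∪ {y | c₁ ∈ P₁ ω₁ ∧ y ∈ insert c₁ (X₂ ω₂)}) - kb (R₂ (E₂ \ ω₂))) else 0)
      + (if ¬ (c₁ ∈ P₁ (E₁ \ ω₁) ∧ c₂ ∈ R₂ (E₂ \ ω₂)) then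
          (ha (P₁ ω₁) - hb (R₂ (E₂ \ ω₂) ∪ {y | c₂ ∈ R₂ (E₂ \ ω₂) ∧ y ∈ insert c₂ (X₁ (E₁ \ ω₁))})) *
          (ka (P₁ ω₁) - kb (R₂ (E₂ \ ω₂) ∪ {y | c₂ ∈ R₂ (E₂ \ ω₂) ∧ y ∈ insert c₂ (X₁ (E₁ \ ω₁))})) else 0)) := by
  have hPR1 : ∀ ω₁ ω₂, c₁ ∈ P₁ ω₁ → P₁ ω₁ ∪ {y | c₁ ∈ P₁ ω₁ ∧ y ∈ insert c₁ (X₂ ω₂)} = P₁ ω₁ ∪ X₂ ω₂ := by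
    intro ω₁ ω₂ hc; ext y; simp only [Set.mem_union, Set.mem_setOf_eq, Set.mem_insert_iff]; constructor
    · rintro (hy | ⟨_, hy | hy⟩); exact Or.inl hy; exact Or.inl (hy ▸ hc); exact Or.inr hy
    · rintro (hy | hy); exact Or.inl hy; exact Or.inr ⟨hc, Or.inr hy⟩
  have hm := bridge_master E₁ E₂ c₁ c₂ a P₁ X₁ X₂ R₂ (fun ω₂ => b ∉ X₂ ω₂) hX₁P₁ hcomm₁ h k ha hb ka kb hh hk ha0 hah hb0 hbh ka0 kak kb0 kbk hOS₁
    (fun ω₁ hω₁ hr => by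
      have h2 := bridgeCell_D2 E₂ b (P₁ ω₁) X₂ R₂
        (fun ω₂ => (P₁ ω₁ ∪ {y | c₁ ∈ P₁ ω₁ ∧ y ∈ insert c₁ (X₂ ω₂)}) ∪ (R₂ ω₂ ∪ {y | c₂ ∈ R₂ ω₂ ∧ y ∈ insert c₂ (X₁ ω₁)}))
        (fun ω₂ _ => by
          intro y hy
          rcases hy with hy | hy | hy
          · exact Or.inl (Or.inl hy)
          · exact Or.inl (Or.inr ⟨hr, Set.mem_insert_of_mem _ hy⟩)
          · exact Or.inr (Or.inl hy))
        h k ha hb ka kb hh hk ka0 kak ha0 hah (hOS₂ (P₁ ω₁))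
      refine le_trans h2 (le_of_eq (Finset.sum_congr rfl fun ω₂ _ => ?_))
      rw [hPR1 ω₁ ω₂ hr]
      split_ifs <;> rfl)
  refine le_trans hm (le_of_eq (Finset.sum_congr rfl fun ω₁ _ => Finset.sum_congr rfl fun ω₂ _ => ?_))
  have hiff : (c₁ ∉ P₁ ω₁ ∨ b ∉ X₂ ω₂) ↔ ¬ (c₁ ∈ P₁ ω₁ ∧ b ∈ X₂ ω₂) := by tauto
  by_cases hc : (c₁ ∉ P₁ ω₁ ∨ b ∉ X₂ ω₂)
  · rw [if_pos hc, if_pos (hiff.mp hc)]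
  · rw [if_neg hc, if_neg (fun hx => hc (hiff.mpr hx))]

open Classical in
/-- **THEOREM B (abstract one-sided extension).**  ONE-SIDED(E₁; c₁, a) (glued by every `B`) and the FREE full anti-sum of `E₂` (glued by every `A`) give
ONE-SIDED(H; b, a) of the bridge: red wall terms over ALL `ω₂` (contact at `b` allowed), blue wall condition `¬(c₁ ∈ P₁(E₁∖ω₁) ∧ c₂ ∈ R₂(E₂∖ω₂))`.
[cite: KozmaNitzan2024, Questions 8–9 (§5.5 p. 36) (context)] -/
theorem bridge_oneSided_abs (E₁ E₂ : Finset ι) (c₁ c₂ a : V) (P₁ X₁ X₂ R₂ : Finset ι → Set V)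
    (hX₁P₁ : ∀ ω₁, ω₁ ⊆ E₁ → c₁ ∈ P₁ ω₁ → X₁ ω₁ ⊆ P₁ ω₁)
    (hcomm₁ : ∀ ω₁, ω₁ ⊆ E₁ → (a ∈ X₁ ω₁ ↔ c₁ ∈ P₁ ω₁))
    (h k ha hb ka kb : Set V → ℝ) (hh : Monotone h) (hk : Monotone k)
    (ha0 : ∀ X, 0 ≤ ha X) (hah : ∀ X, ha X ≤ h X) (hb0 : ∀ X, 0 ≤ hb X) (hbh : ∀ X, hb X ≤ h X)
    (ka0 : ∀ X, 0 ≤ ka X) (kak : ∀ X, ka X ≤ k X) (kb0 : ∀ X, 0 ≤ kb X) (kbk : ∀ X, kb X ≤ k X)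
    (hOS₁ : ∀ B : Set V, 0 ≤ (∑ ω₁ ∈ E₁.powerset, h (B ∪ (X₁ ω₁ ∪ P₁ ω₁)) * k (B ∪ (X₁ ω₁ ∪ P₁ ω₁)))
      + ∑ ω₁ ∈ E₁.powerset.filter (fun ω₁ => a ∉ X₁ ω₁), (hb (B ∪ X₁ ω₁) - ha (P₁ (E₁ \ ω₁))) * (kb (B ∪ X₁ ω₁) - ka (P₁ (E₁ \ ω₁))))
    (hFA₂ : ∀ A : Set V, 0 ≤ (∑ ω₂ ∈ E₂.powerset, h (A ∪ (X₂ ω₂ ∪ R₂ ω₂)) * k (A ∪ (X₂ ω₂ ∪ R₂ ω₂)))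
      + ∑ ω₂ ∈ E₂.powerset, (ha (A ∪ X₂ ω₂) - hb (R₂ (E₂ \ ω₂))) * (ka (A ∪ X₂ ω₂) - kb (R₂ (E₂ \ ω₂)))) :
    0 ≤ ∑ ω₁ ∈ E₁.powerset, ∑ ω₂ ∈ E₂.powerset,
      (h ((P₁ ω₁ ∪ {y | c₁ ∈ P₁ ω₁ ∧ y ∈ insert c₁ (X₂ ω₂)}) ∪ (R₂ ω₂ ∪ {y | c₂ ∈ R₂ ω₂ ∧ y ∈ insert c₂ (X₁ ω₁)})) *
          k ((P₁ ω₁ ∪ {y | c₁ ∈ P₁ ω₁ ∧ y ∈ insert c₁ (X₂ ω₂)}) ∪ (R₂ ω₂ ∪ {y | c₂ ∈ R₂ ω₂ ∧ y ∈ insert c₂ (X₁ ω₁)}))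
      + h (P₁ ω₁ ∪ R₂ ω₂) * k (P₁ ω₁ ∪ R₂ ω₂)
      + (ha (P₁ ω₁ ∪ {y | c₁ ∈ P₁ ω₁ ∧ y ∈ insert c₁ (X₂ ω₂)}) - hb (R₂ (E₂ \ ω₂))) *
          (ka (P₁ ω₁ ∪ {y | c₁ ∈ P₁ ω₁ ∧ y ∈ insert c₁ (X₂ ω₂)}) - kb (R₂ (E₂ \ ω₂)))
      + (if ¬ (c₁ ∈ P₁ (E₁ \ ω₁) ∧ c₂ ∈ R₂ (E₂ \ ω₂)) then
          (ha (P₁ ω₁) - hb (R₂ (E₂ \ ω₂) ∪ {y | c₂ ∈ R₂ (E₂ \ ω₂) ∧ y ∈ insert c₂ (X₁ (E₁ \ ω₁))})) *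
          (ka (P₁ ω₁) - kb (R₂ (E₂ \ ω₂) ∪ {y | c₂ ∈ R₂ (E₂ \ ω₂) ∧ y ∈ insert c₂ (X₁ (E₁ \ ω₁))})) else 0)) := by
  have hPR1 : ∀ ω₁ ω₂, c₁ ∈ P₁ ω₁ → P₁ ω₁ ∪ {y | c₁ ∈ P₁ ω₁ ∧ y ∈ insert c₁ (X₂ ω₂)} = P₁ ω₁ ∪ X₂ ω₂ := by
    intro ω₁ ω₂ hc; ext y; simp only [Set.mem_union, Set.mem_setOf_eq, Set.mem_insert_iff]; constructor
    · rintro (hy | ⟨_, hy | hy⟩); exact Or.inl hy; exact Or.inl (hy ▸ hc); exact Or.inr hy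
    · rintro (hy | hy); exact Or.inl hy; exact Or.inr ⟨hc, Or.inr hy⟩
  have hm := bridge_master E₁ E₂ c₁ c₂ a P₁ X₁ X₂ R₂ (fun _ => True) hX₁P₁ hcomm₁ h k ha hb ka kb hh hk ha0 hah hb0 hbh ka0 kak kb0 kbk hOS₁
    (fun ω₁ hω₁ hr => by
      have h2 := bridgeCell_D2_full E₂ (P₁ ω₁) X₂ R₂
        (fun ω₂ => (P₁ ω₁ ∪ {y | c₁ ∈ P₁ ω₁ ∧ y ∈ insert c₁ (X₂ ω₂)}) ∪ (R₂ ω₂ ∪ {y | c₂ ∈ R₂ ω₂ ∧ y ∈ insert c₂ (X₁ ω₁)}))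
        (fun ω₂ _ => by
          intro y hy
          rcases hy with hy | hy | hy
          · exact Or.inl (Or.inl hy)
          · exact Or.inl (Or.inr ⟨hr, Set.mem_insert_of_mem _ hy⟩)
          · exact Or.inr (Or.inl hy))
        h k ha hb ka kb hh hk ka0 kak ha0 hah (hFA₂ (P₁ ω₁))
      refine le_trans h2 (le_of_eq (Finset.sum_congr rfl fun ω₂ _ => ?_))
      rw [if_pos trivial, hPR1 ω₁ ω₂ hr])
  refine le_trans hm (le_of_eq (Finset.sum_congr rfl fun ω₁ _ => Finset.sum_congr rfl fun ω₂ _ => ?_))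
  rw [if_pos (Or.inr trivial)]

end Coefficientwise

end Summit.CriticalPhenomena.PercolationContinuityZ3.Theorems
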